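/-
Copyright (c) 2026 the pub-hodgecm-mathlib formalisation cell (harness21).  Prover seat hodgecm-mathlib-R90-C131-p02 (g0) (R90-TF S4 hand lent to L1
by CHAIR VALVE WORD W4), Track B «K2-LIT», hLiu418 = `stmt-HodgeConjecture-24832`; LEAD F0P6-plan (g14) BATCH #87 (2) (K1a-3-arch), K1-a♮ line lead
K2E5-p16 (g8) WORD #4 (3) «Φ-ROAD» — ED. 3a of the singular row: the one-variable letter, integrability and the `(β−1)`-recursion.  THEOREMS ONLY
(no `def`, no instance, no notation, no named-fact hypothesis, no `sorry`); lane `--supports stmt-HodgeConjecture-24832 --as helper`.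
-/
import Mathlib.Analysis.SpecialFunctions.Gamma.Beta
import Mathlib.Analysis.SpecialFunctions.Gamma.Deriv
import Mathlib.Analysis.SpecialFunctions.Pow.Deriv
import Mathlib.Analysis.SpecialFunctions.Pow.Asymptotics
import Mathlib.Analysis.Calculus.ParametricIntegral
import Mathlib.MeasureTheory.Integral.IntegralEqImproper
import HarnessLib

/-!
# Crux `HLiu418`, ROAD Φ — the SINGULAR (rank-one) row of the η-sheet, ED. 3a: the one-variable confluent letter
# `J_{p,t}(α, β) = ∫₀^∞ e^{−pr} (r+2t)^{α−2} r^{β−2} dr` of ★ `K2LiuHermTwoEtaRankOneReduction` — integrability and the `(β−1)`-RECURSION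

Cell `hodgecm-mathlib`, crux item hLiu418 = `stmt-HodgeConjecture-24832` (helper lane, count-neutral).  ★ `etaTwo_rankOne_eq` (ED. 1–2) reduced
`η₂(g, diag(t,0); α, β)` ([Shimura1982, §4 Thm. 4.2], `n = 2`, `r = 1`) to `Γ(α+β−2) × J_{p,t}(α, β)` on the abscissa of absolute convergence
(`1 < re β`, `3 < re(α+β)`).  Along the K1 lines `α = s+1+k/2+m`, `β = s+1−k/2+n` the arch singular block must be continued to `{0 < re s}`, i.e.
to `re β > 1 − N` with `N ≈ k/2`; the continuation runs on the one-step recursion of this file (the sequel `K2LiuHermTwoEtaRankOneContinuation`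
does the holomorphy and the induction).
* §1 `integrableOn_exp_mul_rpow_mul_rpow` — `e^{−pr}(r+2t)^a r^b` is integrable on `(0, ∞)` for `p, t > 0`, every real `a`, `b > −1` (majorant
  `e^{−pr} r^b ((2t)^a + (4t)^a + 2^{a⁺} r^{a⁺})`, Gamma integrands Mathlib `Real.GammaIntegral_convergent` after scaling); the two elementary majorant
  letters `rpow_le_rpow_add_rpow` (`r^x ≤ r^{lo} + r^{hi}` for `lo ≤ x ≤ hi`) and `abs_log_le_rpow_add_rpow` (`|log r| ≤ δ⁻¹(r^δ + r^{−δ})`).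
* §2 the complex integrand: `norm_jIntegrand` and `integrableOn_jIntegrand` (`−1 < re δ`).
* §3 **`jIntegral_recursion`** — `(β − 1)·J(α, β) = p·J(α, β+1) − (α − 2)·J(α − 1, β + 1)` on `1 < re β` (integration by parts on `(0,∞)`,
  Mathlib `integral_Ioi_mul_deriv_eq_deriv_mul`; boundary terms vanish: `r^{β−1} → 0` at `0⁺`, exponential decay at `∞`,
  Mathlib `tendsto_rpow_mul_exp_neg_mul_atTop_nhds_zero`).

HONEST LABEL: analytic letters for the arch singular row; closes no socket.  HC_CM is proved only modulo the 7 printed citations (2 remaining named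
inputs: hLiu418 = `stmt-HodgeConjecture-24832`, h413 = `stmt-HodgeConjecture-24833`) until rung 0 closes.  REL ≠ ★ ≠ BUILT.

## References
* [Shimura1982] G. Shimura, *Confluent hypergeometric functions on tube domains*, Math. Ann. 260 (1982), §3 Thm. 3.1 (continuation by parts), §4 Thm. 4.2.
* [Shimura1997] G. Shimura, *Euler Products and Eisenstein Series*, CBMS 93 (1997), §16.4, §18.4–18.5.
-/

set_option autoImplicit false
set_option linter.dupNamespace false

noncomputable section

open Complex MeasureTheory Set Filter Real
open scoped Topology

namespace Summit.HodgeConjecture.HodgeConjecture.Cruxes.HLiu418.K2LiuHermTwoEtaRankOneLetter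

/-! ## §1 Real majorants and the integrability workhorse on `(0, ∞)` -/

/-- `r^x ≤ r^{lo} + r^{hi}` for `0 < r` and `lo ≤ x ≤ hi` (use `r^{lo}` on `r ≤ 1`, `r^{hi}` on `1 ≤ r`). [folklore] -/
theorem rpow_le_rpow_add_rpow {r : ℝ} (hr : 0 < r) {x lo hi : ℝ} (h1 : lo ≤ x) (h2 : x ≤ hi) : r ^ x ≤ r ^ lo + r ^ hi := by
  have hlo : 0 ≤ r ^ lo := Real.rpow_nonneg hr.le _
  have hhi : 0 ≤ r ^ hi := Real.rpow_nonneg hr.le _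
  rcases le_or_gt r 1 with h | h
  · have : r ^ x ≤ r ^ lo := Real.rpow_le_rpow_of_exponent_ge hr h h1
    linarith
  · have : r ^ x ≤ r ^ hi := Real.rpow_le_rpow_of_exponent_le h.le h2
    linarith

/-- `|log r| ≤ δ⁻¹ (r^δ + r^{−δ})` for `0 < r`, `0 < δ` (`log r ≤ r^δ/δ` and `−log r = log r⁻¹ ≤ r^{−δ}/δ`). [folklore] -/
theorem abs_log_le_rpow_add_rpow {r : ℝ} (hr : 0 < r) {δ : ℝ} (hδ : 0 < δ) : |Real.log r| ≤ δ⁻¹ * (r ^ δ + r ^ (-δ)) := by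
  have h1 : Real.log r ≤ r ^ δ / δ := Real.log_le_rpow_div hr.le hδ
  have h2 : -Real.log r ≤ r ^ (-δ) / δ := by
    have := Real.log_le_rpow_div (inv_nonneg.mpr hr.le) hδ
    rwa [Real.log_inv, Real.inv_rpow hr.le, ← Real.rpow_neg hr.le] at this
  have hp1 : 0 ≤ r ^ δ / δ := div_nonneg (Real.rpow_nonneg hr.le _) hδ.le
  have hp2 : 0 ≤ r ^ (-δ) / δ := div_nonneg (Real.rpow_nonneg hr.le _) hδ.le
  rw [abs_le]
  constructor
  · have : -(δ⁻¹ * (r ^ δ + r ^ (-δ))) ≤ -(r ^ (-δ) / δ) := by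
      rw [neg_le_neg_iff, mul_add, ← div_eq_inv_mul, ← div_eq_inv_mul]
      linarith
    linarith
  · rw [mul_add, ← div_eq_inv_mul, ← div_eq_inv_mul]
    linarith

/-- `(r + 2t)^a ≤ (2t)^a + (4t)^a + 2^{max a 0} · r^{max a 0}` for `r, t > 0` and every real `a`. [folklore] -/
theorem add_rpow_le (a : ℝ) {r t : ℝ} (hr : 0 < r) (ht : 0 < t) :
    (r + 2 * t) ^ a ≤ (2 * t) ^ a + (4 * t) ^ a + (2 : ℝ) ^ (max a 0) * r ^ (max a 0) := by
  have h2t : 0 < 2 * t := by positivity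
  have h4t : 0 ≤ (4 * t) ^ a := Real.rpow_nonneg (by positivity) _
  have h2ta : 0 ≤ (2 * t) ^ a := Real.rpow_nonneg h2t.le _
  have hlast : 0 ≤ (2 : ℝ) ^ (max a 0) * r ^ (max a 0) := mul_nonneg (Real.rpow_nonneg (by norm_num) _) (Real.rpow_nonneg hr.le _)
  rcases le_or_gt a 0 with ha | ha
  · -- `a ≤ 0`: antitone in the base, `2t ≤ r + 2t`
    have : (r + 2 * t) ^ a ≤ (2 * t) ^ a := Real.rpow_le_rpow_of_nonpos h2t (by linarith) ha
    linarith
  · -- `0 < a`: `r + 2t ≤ 2 max(r, 2t)` and `max^a ≤ sum`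
    have hmax : max a 0 = a := max_eq_left ha.le
    rw [hmax]
    have hlast' : 0 ≤ (2 : ℝ) ^ a * r ^ a := mul_nonneg (Real.rpow_nonneg (by norm_num) _) (Real.rpow_nonneg hr.le _)
    rcases le_or_gt r (2 * t) with hrt | hrt
    · have : (r + 2 * t) ^ a ≤ (4 * t) ^ a := Real.rpow_le_rpow (by positivity) (by linarith) ha.le
      linarith
    · have h2r : (r + 2 * t) ^ a ≤ (2 * r) ^ a := Real.rpow_le_rpow (by positivity) (by linarith) ha.le
      rw [Real.mul_rpow (by norm_num) hr.le] at h2r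
      linarith

/-- `e^{−pr} r^b` is integrable on `(0,∞)` for `p > 0`, `b > −1` (scaled Gamma integrand). [folklore] -/
theorem integrableOn_exp_mul_rpow {p : ℝ} (hp : 0 < p) {b : ℝ} (hb : -1 < b) :
    IntegrableOn (fun r : ℝ => Real.exp (-(p * r)) * r ^ b) (Ioi 0) := by
  have hG := Real.GammaIntegral_convergent (s := b + 1) (by linarith)
  simp only [add_sub_cancel_right] at hG
  have h := (integrableOn_Ioi_comp_mul_left_iff (fun x : ℝ => Real.exp (-x) * x ^ b) 0 hp).mpr (by simpa using hG)
  have h' : IntegrableOn (fun r : ℝ => p ^ b * (Real.exp (-(p * r)) * r ^ b)) (Ioi 0) := by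
    refine h.congr_fun (fun r hr => ?_) measurableSet_Ioi
    simp only
    rw [Real.mul_rpow hp.le (le_of_lt hr)]
    ring
  have h'' : IntegrableOn (fun r : ℝ => (p ^ b)⁻¹ * (p ^ b * (Real.exp (-(p * r)) * r ^ b))) (Ioi 0) := h'.const_mul _
  refine h''.congr_fun (fun r _ => ?_) measurableSet_Ioi
  simp only
  rw [← mul_assoc, inv_mul_cancel₀ (Real.rpow_pos_of_pos hp b).ne', one_mul]

/-- **The workhorse**: `e^{−pr} (r+2t)^a r^b` is integrable on `(0, ∞)` for `p, t > 0`, every real `a` and `b > −1`. [Shimura1982, §3] -/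
theorem integrableOn_exp_mul_rpow_mul_rpow {p t : ℝ} (hp : 0 < p) (ht : 0 < t) (a : ℝ) {b : ℝ} (hb : -1 < b) :
    IntegrableOn (fun r : ℝ => Real.exp (-(p * r)) * ((r + 2 * t) ^ a * r ^ b)) (Ioi 0) := by
  have hm : 0 ≤ max a 0 := le_max_right _ _
  -- the majorant
  have hM : IntegrableOn (fun r : ℝ => ((2 * t) ^ a + (4 * t) ^ a) * (Real.exp (-(p * r)) * r ^ b) +
      (2 : ℝ) ^ (max a 0) * (Real.exp (-(p * r)) * r ^ (b + max a 0))) (Ioi 0) :=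
    ((integrableOn_exp_mul_rpow hp hb).const_mul _).add ((integrableOn_exp_mul_rpow hp (by linarith)).const_mul _)
  have hcont : ContinuousOn (fun r : ℝ => Real.exp (-(p * r)) * ((r + 2 * t) ^ a * r ^ b)) (Ioi 0) := by
    intro r hr
    have hr' : (0 : ℝ) < r := hr
    exact ((Real.continuous_exp.comp (by fun_prop)).continuousAt.mul
      (((continuous_id.add continuous_const).continuousAt.rpow_const (Or.inl (by positivity : r + 2 * t ≠ 0))).mul
        (continuousAt_id.rpow_const (Or.inl hr'.ne')))).continuousWithinAt
  refine Integrable.mono' hM (hcont.aestronglyMeasurable measurableSet_Ioi) ?_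
  refine (ae_restrict_iff' measurableSet_Ioi).2 (Eventually.of_forall fun r hr => ?_)
  have hr' : (0 : ℝ) < r := hr
  have he : 0 < Real.exp (-(p * r)) := Real.exp_pos _
  have hrb : 0 ≤ r ^ b := Real.rpow_nonneg hr'.le _
  rw [Real.norm_eq_abs, abs_of_nonneg (mul_nonneg he.le (mul_nonneg (Real.rpow_nonneg (by positivity) _) hrb)),
    Real.rpow_add hr', show Real.exp (-(p * r)) * ((r + 2 * t) ^ a * r ^ b) = (r + 2 * t) ^ a * (Real.exp (-(p * r)) * r ^ b) by ring]
  have key := add_rpow_le a hr' ht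
  calc (r + 2 * t) ^ a * (Real.exp (-(p * r)) * r ^ b)
      ≤ ((2 * t) ^ a + (4 * t) ^ a + (2 : ℝ) ^ (max a 0) * r ^ (max a 0)) * (Real.exp (-(p * r)) * r ^ b) :=
        mul_le_mul_of_nonneg_right key (mul_nonneg he.le hrb)
    _ = ((2 * t) ^ a + (4 * t) ^ a) * (Real.exp (-(p * r)) * r ^ b) +
          (2 : ℝ) ^ (max a 0) * (Real.exp (-(p * r)) * (r ^ b * r ^ (max a 0))) := by ring

/-! ## §2 The complex integrand `e^{−pr} (r+2t)^{γ} r^{δ}` -/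

/-- the norm of the complex integrand at `r > 0` is the real integrand at the real parts. [folklore] -/
theorem norm_jIntegrand {p t : ℝ} (ht : 0 < t) (γ δ : ℂ) {r : ℝ} (hr : 0 < r) :
    ‖cexp (-((p * r : ℝ) : ℂ)) * ((((r + 2 * t : ℝ)) : ℂ) ^ γ * ((r : ℝ) : ℂ) ^ δ)‖ =
      Real.exp (-(p * r)) * ((r + 2 * t) ^ γ.re * r ^ δ.re) := by
  have h1 : 0 < r + 2 * t := by positivity
  rw [norm_mul, norm_mul, Complex.norm_exp, Complex.norm_cpow_eq_rpow_re_of_pos h1, Complex.norm_cpow_eq_rpow_re_of_pos hr]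
  simp

/-- **the complex integrand is integrable on `(0,∞)`** for `p, t > 0`, every `γ` and `−1 < re δ`. [Shimura1982, §3] -/
theorem integrableOn_jIntegrand {p t : ℝ} (hp : 0 < p) (ht : 0 < t) (γ : ℂ) {δ : ℂ} (hδ : -1 < δ.re) :
    IntegrableOn (fun r : ℝ => cexp (-((p * r : ℝ) : ℂ)) * ((((r + 2 * t : ℝ)) : ℂ) ^ γ * ((r : ℝ) : ℂ) ^ δ)) (Ioi 0) := by
  have hcont : ContinuousOn (fun r : ℝ => cexp (-((p * r : ℝ) : ℂ)) * ((((r + 2 * t : ℝ)) : ℂ) ^ γ * ((r : ℝ) : ℂ) ^ δ)) (Ioi 0) := by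
    intro r hr
    have hr' : (0 : ℝ) < r := hr
    refine ContinuousAt.continuousWithinAt ?_
    refine (by fun_prop : ContinuousAt (fun r : ℝ => cexp (-((p * r : ℝ) : ℂ))) r).mul (ContinuousAt.mul ?_ ?_)
    · exact ((Complex.continuous_ofReal.comp (by fun_prop : Continuous fun r : ℝ => r + 2 * t)).continuousAt).cpow
        continuousAt_const (Or.inl (by rw [Function.comp_apply, Complex.ofReal_re]; positivity))
    · exact (Complex.continuous_ofReal.continuousAt).cpow continuousAt_const (Or.inl (by rw [Complex.ofReal_re]; exact hr'))
  refine Integrable.mono' (integrableOn_exp_mul_rpow_mul_rpow hp ht γ.re hδ) (hcont.aestronglyMeasurable measurableSet_Ioi) ?_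
  refine (ae_restrict_iff' measurableSet_Ioi).2 (Eventually.of_forall fun r hr => ?_)
  rw [norm_jIntegrand ht γ δ hr]

/-! ## §3 The `(β − 1)`-recursion (integration by parts on `(0, ∞)`) -/

/-- cast bookkeeping: the J-integrand in «real-product» and «complex-product» spellings agree. [folklore] -/
theorem jIntegrand_cast (p t : ℝ) (γ δ : ℂ) (r : ℝ) :
    cexp (-((p * r : ℝ) : ℂ)) * ((((r + 2 * t : ℝ)) : ℂ) ^ γ * ((r : ℝ) : ℂ) ^ δ) =
      cexp (-((p : ℂ) * (r : ℂ))) * (((r : ℂ) + 2 * (t : ℂ)) ^ γ * ((r : ℝ) : ℂ) ^ δ) := by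
  push_cast
  ring_nf

/-- the J-integrand in the complex-product spelling is integrable on `(0,∞)` (`−1 < re δ`). [Shimura1982, §3] -/
theorem integrableOn_jIntegrand' {p t : ℝ} (hp : 0 < p) (ht : 0 < t) (γ : ℂ) {δ : ℂ} (hδ : -1 < δ.re) :
    IntegrableOn (fun r : ℝ => cexp (-((p : ℂ) * (r : ℂ))) * (((r : ℂ) + 2 * (t : ℂ)) ^ γ * ((r : ℝ) : ℂ) ^ δ)) (Ioi 0) :=
  (integrableOn_jIntegrand hp ht γ hδ).congr_fun (fun r _ => jIntegrand_cast p t γ δ r) measurableSet_Ioi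

/-- norm of the product `u · v` of the integration by parts: `‖e^{−pr}(r+2t)^{α−2} · r^{β−1}‖ = e^{−pr}(r+2t)^{re α−2} r^{re β−1}` (`r > 0`). [folklore] -/
theorem norm_uv {p t : ℝ} (ht : 0 < t) (α β : ℂ) {r : ℝ} (hr : 0 < r) :
    ‖cexp (-((p : ℂ) * (r : ℂ))) * ((r : ℂ) + 2 * (t : ℂ)) ^ (α - 2) * ((r : ℝ) : ℂ) ^ (β - 1)‖ =
      Real.exp (-(p * r)) * (r + 2 * t) ^ (α.re - 2) * r ^ (β.re - 1) := by
  have h := norm_jIntegrand (p := p) ht (α - 2) (β - 1) hr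
  rw [jIntegrand_cast, ← mul_assoc] at h
  rw [h]
  simp only [sub_re, re_ofNat, one_re]
  ring

/-- **THE RECURSION** ([Shimura1982, §3], one step of the continuation of Thm. 3.1 in one variable): for `p, t > 0`, every `α`, and `1 < re β`,
`(β − 1) · J(α, β) = p · J(α, β + 1) − (α − 2) · J(α − 1, β + 1)`, `J(α, β) = ∫₀^∞ e^{−pr}(r+2t)^{α−2} r^{β−2} dr`
(integration by parts with `u = e^{−pr}(r+2t)^{α−2}`, `v = r^{β−1}`; the boundary terms vanish: `r^{β−1} → 0` at `0⁺` since `re β > 1`, and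
`e^{−pr}` beats every power at `∞`). [Shimura1982, §3 Thm. 3.1] -/
theorem jIntegral_recursion {p t : ℝ} (hp : 0 < p) (ht : 0 < t) (α : ℂ) {β : ℂ} (hβ : 1 < β.re) :
    (β - 1) * (∫ r in Ioi (0 : ℝ), cexp (-((p * r : ℝ) : ℂ)) * ((((r + 2 * t : ℝ)) : ℂ) ^ (α - 2) * ((r : ℝ) : ℂ) ^ (β - 2))) =
      (p : ℂ) * (∫ r in Ioi (0 : ℝ), cexp (-((p * r : ℝ) : ℂ)) * ((((r + 2 * t : ℝ)) : ℂ) ^ (α - 2) * ((r : ℝ) : ℂ) ^ (β + 1 - 2))) -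
      (α - 2) * (∫ r in Ioi (0 : ℝ), cexp (-((p * r : ℝ) : ℂ)) * ((((r + 2 * t : ℝ)) : ℂ) ^ (α - 1 - 2) * ((r : ℝ) : ℂ) ^ (β + 1 - 2))) := by
  -- pass to the complex-product spelling
  simp_rw [jIntegrand_cast]
  have hβ1 : β - 1 ≠ 0 := fun h => by
    have := congrArg Complex.re h; simp only [sub_re, one_re, zero_re] at this; linarith
  -- the four functions
  set u : ℝ → ℂ := fun r => cexp (-((p : ℂ) * (r : ℂ))) * ((r : ℂ) + 2 * (t : ℂ)) ^ (α - 2) with hu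
  set u' : ℝ → ℂ := fun r => -(p : ℂ) * (cexp (-((p : ℂ) * (r : ℂ))) * ((r : ℂ) + 2 * (t : ℂ)) ^ (α - 2)) +
    (α - 2) * (cexp (-((p : ℂ) * (r : ℂ))) * ((r : ℂ) + 2 * (t : ℂ)) ^ (α - 1 - 2)) with hu'
  set v : ℝ → ℂ := fun r => ((r : ℝ) : ℂ) ^ (β - 1) with hv
  set v' : ℝ → ℂ := fun r => (β - 1) * ((r : ℝ) : ℂ) ^ (β - 2) with hv'
  -- derivatives on `(0, ∞)`
  have hdu : ∀ r ∈ Ioi (0 : ℝ), HasDerivAt u (u' r) r := by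
    intro r hr
    have hr' : (0 : ℝ) < r := hr
    have hslit : ((r : ℂ) + 2 * (t : ℂ)) ∈ slitPlane := by
      rw [show ((r : ℂ) + 2 * (t : ℂ)) = ((r + 2 * t : ℝ) : ℂ) by push_cast; ring]
      exact Complex.ofReal_mem_slitPlane.2 (by positivity)
    have he : HasDerivAt (fun z : ℂ => cexp (-((p : ℂ) * z))) (cexp (-((p : ℂ) * (r : ℂ))) * (-(p : ℂ))) (r : ℂ) := by
      have h1 : HasDerivAt (fun z : ℂ => -((p : ℂ) * z)) (-(p : ℂ)) (r : ℂ) := by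
        have h := ((hasDerivAt_id (r : ℂ)).const_mul (p : ℂ)).neg
        simp only [id_eq, mul_one] at h
        exact h
      exact h1.cexp
    have hpw : HasDerivAt (fun z : ℂ => (z + 2 * (t : ℂ)) ^ (α - 2)) ((α - 2) * ((r : ℂ) + 2 * (t : ℂ)) ^ (α - 2 - 1) * 1) (r : ℂ) :=
      ((hasDerivAt_id (r : ℂ)).add_const (2 * (t : ℂ))).cpow_const hslit
    have hprod := (he.mul hpw).comp_ofReal
    simp only [hu, hu']
    convert hprod using 1
    · funext y
      simp only [Pi.mul_apply]
    · rw [show α - 2 - 1 = α - 1 - 2 by ring]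
      ring
  have hdv : ∀ r ∈ Ioi (0 : ℝ), HasDerivAt v (v' r) r := by
    intro r hr
    have hr' : (0 : ℝ) < r := hr
    have h := hasDerivAt_ofReal_cpow_const hr'.ne' hβ1
    simp only [hv, hv']
    rw [show β - 2 = β - 1 - 1 by ring]
    exact h
  -- integrability of `u v'` and `u' v`
  have hβ2 : -1 < (β - 2).re := by simp only [sub_re, re_ofNat]; linarith
  have hβ1re : -1 < (β + 1 - 2).re := by simp only [sub_re, add_re, one_re, re_ofNat]; linarith
  have huv' : IntegrableOn (u * v') (Ioi 0) := by
    have h := (integrableOn_jIntegrand' hp ht (α - 2) hβ2).const_mul (β - 1)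
    refine IntegrableOn.congr_fun h (fun r _ => ?_) measurableSet_Ioi
    simp only [hu, hv', Pi.mul_apply]
    ring
  have hu'v : IntegrableOn (u' * v) (Ioi 0) := by
    have h1 := (integrableOn_jIntegrand' hp ht (α - 2) hβ1re).const_mul (-(p : ℂ))
    have h2 := (integrableOn_jIntegrand' hp ht (α - 1 - 2) hβ1re).const_mul (α - 2)
    refine IntegrableOn.congr_fun (h1.add h2) (fun r _ => ?_) measurableSet_Ioi
    simp only [hu', hv, Pi.mul_apply, Pi.add_apply]
    rw [show β + 1 - 2 = β - 1 by ring]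
    ring
  -- boundary term at `0⁺`
  have h_zero : Tendsto (u * v) (𝓝[>] 0) (𝓝 0) := by
    have hcu : ContinuousAt u 0 := by
      simp only [hu]
      refine (by fun_prop : ContinuousAt (fun r : ℝ => cexp (-((p : ℂ) * (r : ℂ)))) 0).mul ?_
      have h0 : ((((0 : ℝ) : ℂ)) + 2 * (t : ℂ)) ∈ slitPlane := by
        rw [show (((0 : ℝ) : ℂ)) + 2 * (t : ℂ) = ((2 * t : ℝ) : ℂ) by push_cast; ring]
        exact Complex.ofReal_mem_slitPlane.2 (by positivity)
      exact ((Complex.continuous_ofReal.continuousAt).add continuousAt_const).cpow continuousAt_const h0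
    have hv0 : Tendsto v (𝓝[>] 0) (𝓝 0) := by
      rw [tendsto_zero_iff_norm_tendsto_zero]
      have hβ' : 0 < β.re - 1 := by linarith
      have hc : Tendsto (fun r : ℝ => r ^ (β.re - 1)) (𝓝[>] 0) (𝓝 0) := by
        have h : Tendsto (fun r : ℝ => r ^ (β.re - 1)) (𝓝[>] 0) (𝓝 ((0 : ℝ) ^ (β.re - 1))) :=
          ((Real.continuous_rpow_const hβ'.le).tendsto 0).mono_left (nhdsWithin_le_nhds (s := Ioi 0))
        rwa [Real.zero_rpow hβ'.ne'] at h
      refine hc.congr' ?_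
      filter_upwards [self_mem_nhdsWithin] with r hr
      simp only [hv]
      rw [Complex.norm_cpow_eq_rpow_re_of_pos hr]
      simp only [sub_re, one_re]
    have := (hcu.tendsto.mono_left nhdsWithin_le_nhds).mul hv0
    rw [mul_zero] at this
    exact this
  -- boundary term at `∞`
  have h_infty : Tendsto (u * v) atTop (𝓝 0) := by
    rw [tendsto_zero_iff_norm_tendsto_zero]
    -- majorant `e^{-pr} r^{re β - 1} ((2t)^a + (4t)^a + 2^{a⁺} r^{a⁺})`, `a = re α - 2`
    set a : ℝ := α.re - 2 with ha
    have hlim : Tendsto (fun r : ℝ => ((2 * t) ^ a + (4 * t) ^ a) * (r ^ (β.re - 1) * Real.exp (-p * r)) +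
        (2 : ℝ) ^ (max a 0) * (r ^ (β.re - 1 + max a 0) * Real.exp (-p * r))) atTop (𝓝 0) := by
      have h1 := (tendsto_rpow_mul_exp_neg_mul_atTop_nhds_zero (β.re - 1) p hp).const_mul ((2 * t) ^ a + (4 * t) ^ a)
      have h2 := (tendsto_rpow_mul_exp_neg_mul_atTop_nhds_zero (β.re - 1 + max a 0) p hp).const_mul ((2 : ℝ) ^ (max a 0))
      simpa using h1.add h2
    refine squeeze_zero_norm' ?_ hlim
    filter_upwards [eventually_gt_atTop (0 : ℝ)] with r hr
    rw [norm_norm, Pi.mul_apply]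
    simp only [hu, hv]
    rw [norm_uv ht α β hr]
    have he : 0 < Real.exp (-(p * r)) := Real.exp_pos _
    have hrb : 0 ≤ r ^ (β.re - 1) := Real.rpow_nonneg hr.le _
    have key := add_rpow_le a hr ht
    rw [show -p * r = -(p * r) by ring, Real.rpow_add hr]
    calc Real.exp (-(p * r)) * (r + 2 * t) ^ a * r ^ (β.re - 1)
        = (r + 2 * t) ^ a * (Real.exp (-(p * r)) * r ^ (β.re - 1)) := by ring
      _ ≤ ((2 * t) ^ a + (4 * t) ^ a + (2 : ℝ) ^ (max a 0) * r ^ (max a 0)) * (Real.exp (-(p * r)) * r ^ (β.re - 1)) :=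
          mul_le_mul_of_nonneg_right key (mul_nonneg he.le hrb)
      _ = ((2 * t) ^ a + (4 * t) ^ a) * (r ^ (β.re - 1) * Real.exp (-(p * r))) +
            (2 : ℝ) ^ (max a 0) * (r ^ (β.re - 1) * r ^ (max a 0) * Real.exp (-(p * r))) := by ring
  -- integrate by parts
  have hIBP := integral_Ioi_mul_deriv_eq_deriv_mul hdu hdv huv' hu'v h_zero h_infty
  -- read the three integrals off
  have hL : (∫ r in Ioi (0 : ℝ), u r * v' r) =
      (β - 1) * ∫ r in Ioi (0 : ℝ), cexp (-((p : ℂ) * (r : ℂ))) * (((r : ℂ) + 2 * (t : ℂ)) ^ (α - 2) * ((r : ℝ) : ℂ) ^ (β - 2)) := by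
    rw [← integral_const_mul]
    refine setIntegral_congr_fun measurableSet_Ioi fun r _ => ?_
    simp only [hu, hv']
    ring
  have hR : (∫ r in Ioi (0 : ℝ), u' r * v r) =
      -(p : ℂ) * (∫ r in Ioi (0 : ℝ), cexp (-((p : ℂ) * (r : ℂ))) * (((r : ℂ) + 2 * (t : ℂ)) ^ (α - 2) * ((r : ℝ) : ℂ) ^ (β + 1 - 2))) +
      (α - 2) * (∫ r in Ioi (0 : ℝ), cexp (-((p : ℂ) * (r : ℂ))) * (((r : ℂ) + 2 * (t : ℂ)) ^ (α - 1 - 2) * ((r : ℝ) : ℂ) ^ (β + 1 - 2))) := by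
    rw [← integral_const_mul, ← integral_const_mul, ← integral_add]
    · refine setIntegral_congr_fun measurableSet_Ioi fun r _ => ?_
      simp only [hu', hv]
      rw [show β + 1 - 2 = β - 1 by ring]
      ring
    · exact (integrableOn_jIntegrand' hp ht (α - 2) hβ1re).const_mul _
    · exact (integrableOn_jIntegrand' hp ht (α - 1 - 2) hβ1re).const_mul _
  rw [hL, hR, sub_zero] at hIBP
  rw [hIBP]
  ring

end Summit.HodgeConjecture.HodgeConjecture.Cruxes.HLiu418.K2LiuHermTwoEtaRankOneLetter

end
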